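import Literature.Analysis.PDE.SemilinearHeatWellPosed
import Literature.MathematicalPhysics.QuantumLattice.YangMillsHeatFlowSemilinear
import HarnessLib

/-!
# Local well-posedness of semilinear heat systems on the flat torus, and the Yang–Mills heat flow
# on `T⁴` from Waldron's Theorem 1.1 alone

Mathematical Physics / Quantum Lattice (`QuantumLattice/`). The last input of the reduction of
the named fact `Waldron2019_yangMillsFlow_flatTorus` (global smooth solutions of the Yang–Mills
heat flow on the flat 4-torus; A. Waldron, *Long-time existence for Yang–Mills flow*, Invent.
math. 217 (2019), Cor. 1.2) carried out in this directory: the hypothesis `hSL` of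
`Waldron2019_yangMillsFlow_flatTorus_of_semilinearHeatFree_of_thm11` — **local well-posedness of
semilinear heat systems `∂ₜu = Σ_μ ∂_μ∂_μ u + f(x, u, ∂u)` on the flat torus `ℝᵈ/Lℤᵈ`** for smooth
`L`-periodic `f` and data (Taylor, *PDE III*, Ch. 15, §1) — is now a theorem
(`semilinearHeat_wellPosed_flatTorus`), by the whole-space theory of
`Literature/Analysis/PDE/SemilinearHeat{Mild,Bootstrap,Classical,WellPosed}.lean` applied to
periodic data (periodicity makes all derivatives of `f` bounded on `ℝᵈ × {‖w‖ ≤ R}` and all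
derivatives of `u₀` bounded, by compactness of the fundamental cell; the solution is periodic by
uniqueness). Consequently **`Waldron2019_yangMillsFlow_flatTorus` follows from Waldron's
Theorem 1.1 alone** (`Waldron2019_yangMillsFlow_flatTorus_of_thm11`), taken verbatim on the
closed flat torus: hypothesis (1.1), conclusion "`lim_{t → T} A(t)` exists in `C^∞_loc`".

* `apply_periodic_lattice`, `exists_mem_cell_of_periodic` — reduction of a lattice-periodic
  function to the fundamental cell `[0, L]ᵈ`;
* `exists_bound_of_latticePeriodic` — a continuous function on `ℝᵈ × W`, `L`-periodic in the first
  variable, is bounded on `ℝᵈ × {‖w‖ ≤ R}` (`W` proper);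
* `semilinearHeat_wellPosed_flatTorus` — the theorem `hSL`;
* `Waldron2019_yangMillsFlow_flatTorus_of_thm11` — the named fact from Thm. 1.1.

## References

* A. Waldron, *Long-time existence for Yang–Mills flow*, Invent. math. 217 (2019), 1069–1147,
  Thm. 1.1, Cor. 1.2, p. 3. [Waldron2019]
* M. E. Taylor, *Partial Differential Equations III. Nonlinear Equations*, 2nd ed., Springer
  (2011), Ch. 15, §1 (semilinear parabolic equations). [TaylorPDEIII2011]
* M. Struwe, *The Yang–Mills flow in four dimensions*, Calc. Var. PDE 2 (1994), §4.1. [Struwe1994]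
-/

noncomputable section

open MeasureTheory Set Function Filter Metric Real
open _root_.Topology
open scoped ENNReal NNReal ContDiff Laplacian

namespace Literature.MathematicalPhysics.QuantumLattice

open Literature.Analysis.PDE.SemilinearHeat Literature.Analysis.FluidPDE

/-! ### Lattice-periodic functions: reduction to the fundamental cell -/

section Periodic

variable {ι : Type} [Fintype ι] [DecidableEq ι]
variable {X : Type*}

/-- A function on `ℝ^ι` which is invariant under `x ↦ x + L eᵢ` for every `i` is invariant under
the whole lattice `Lℤ^ι`: `g(x + Σᵢ mᵢ L eᵢ) = g(x)` for `m ∈ ℤ^ι`. [folklore] -/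
theorem apply_periodic_lattice {g : EuclideanSpace ℝ ι → X} {L : ℝ}
    (hg : ∀ (x : EuclideanSpace ℝ ι) (i : ι), g (x + EuclideanSpace.single i L) = g x)
    (m : ι → ℤ) (x : EuclideanSpace ℝ ι) :
    g (x + ∑ i, ((m i : ℝ) • EuclideanSpace.single i L)) = g x := by
  classical
  -- one direction at a time, any integer multiple
  have hone : ∀ (i : ι) (n : ℤ) (y : EuclideanSpace ℝ ι), g (y + (n : ℝ) • EuclideanSpace.single i L) = g y := by
    intro i n
    induction n using Int.induction_on with
    | zero => intro y; simp
    | succ n ih =>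
      intro y
      have e : (((n : ℤ) + 1 : ℤ) : ℝ) • EuclideanSpace.single i L =
          ((n : ℤ) : ℝ) • EuclideanSpace.single i L + EuclideanSpace.single i L := by
        rw [Int.cast_add, Int.cast_one, add_smul, one_smul]
      rw [e, ← add_assoc, hg]
      exact ih y
    | pred n ih =>
      intro y
      have e : ((-(n : ℤ) - 1 : ℤ) : ℝ) • EuclideanSpace.single i L =
          ((-(n : ℤ) : ℤ) : ℝ) • EuclideanSpace.single i L - EuclideanSpace.single i L := by
        rw [Int.cast_sub, Int.cast_one, sub_smul, one_smul]
      rw [e, ← add_sub_assoc]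
      have h := hg (y + ((-(n : ℤ) : ℤ) : ℝ) • EuclideanSpace.single i L - EuclideanSpace.single i L) i
      rw [sub_add_cancel] at h
      rw [← h]
      exact ih y
  -- sum over the directions
  suffices h : ∀ (s : Finset ι) (y : EuclideanSpace ℝ ι),
      g (y + ∑ i ∈ s, ((m i : ℝ) • EuclideanSpace.single i L)) = g y from h Finset.univ x
  intro s
  induction s using Finset.induction_on with
  | empty => intro y; simp
  | insert i s hi ih =>
    intro y
    rw [Finset.sum_insert hi, ← add_assoc, ih (y + _), hone]

/-- **Reduction to the fundamental cell**: for `L > 0`, every `x ∈ ℝ^ι` is a lattice translate of a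
point of `[0, L]^ι`, so an `L`-periodic function takes at `x` a value taken on the cell.
[folklore] -/
theorem exists_mem_cell_of_periodic {g : EuclideanSpace ℝ ι → X} {L : ℝ} (hL : 0 < L)
    (hg : ∀ (x : EuclideanSpace ℝ ι) (i : ι), g (x + EuclideanSpace.single i L) = g x)
    (x : EuclideanSpace ℝ ι) :
    ∃ x₀ : EuclideanSpace ℝ ι, WithLp.ofLp x₀ ∈ Icc (0 : ι → ℝ) (fun _ => L) ∧ g x = g x₀ := by
  classical
  set m : ι → ℤ := fun i => -⌊x i / L⌋ with hm
  refine ⟨x + ∑ i, ((m i : ℝ) • EuclideanSpace.single i L), ?_, (apply_periodic_lattice hg m x).symm⟩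
  have hcoord : ∀ j, (x + ∑ i, ((m i : ℝ) • EuclideanSpace.single i L)) j = x j - ⌊x j / L⌋ * L := by
    intro j
    simp only [hm, PiLp.add_apply, WithLp.ofLp_sum, Finset.sum_apply, PiLp.smul_apply,
      PiLp.single_apply, smul_eq_mul, mul_ite, mul_zero, Finset.sum_ite_eq,
      Finset.mem_univ, if_true, Int.cast_neg]
    ring
  refine ⟨fun j => ?_, fun j => ?_⟩
  · change (0 : ℝ) ≤ (x + ∑ i, ((m i : ℝ) • EuclideanSpace.single i L)) j
    rw [hcoord]
    have h := Int.floor_le (x j / L)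
    have : (⌊x j / L⌋ : ℝ) * L ≤ x j := by
      calc (⌊x j / L⌋ : ℝ) * L ≤ (x j / L) * L := mul_le_mul_of_nonneg_right h hL.le
        _ = x j := div_mul_cancel₀ _ hL.ne'
    linarith
  · change (x + ∑ i, ((m i : ℝ) • EuclideanSpace.single i L)) j ≤ L
    rw [hcoord]
    have h := Int.lt_floor_add_one (x j / L)
    have : x j < ((⌊x j / L⌋ : ℝ) + 1) * L := by
      calc x j = (x j / L) * L := (div_mul_cancel₀ _ hL.ne').symm
        _ < ((⌊x j / L⌋ : ℝ) + 1) * L := mul_lt_mul_of_pos_right h hL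
    linarith

/-- **Continuous periodic functions are bounded on `ℝ^ι × {‖w‖ ≤ R}`**: for `F : ℝ^ι × W → X`
continuous and `L`-periodic in the first variable (`L > 0`, `W` proper), `‖F(x, w)‖ ≤ B` for all
`x` and `‖w‖ ≤ R` (compactness of `[0, L]^ι × B̄(0, R)`). [folklore] -/
theorem exists_bound_of_latticePeriodic {W : Type*} [NormedAddCommGroup W] [ProperSpace W]
    [NormedAddCommGroup X] {F : EuclideanSpace ℝ ι × W → X} (hF : Continuous F) {L : ℝ} (hL : 0 < L)
    (hFp : ∀ (x : EuclideanSpace ℝ ι) (i : ι) (w : W), F (x + EuclideanSpace.single i L, w) = F (x, w))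
    (R : ℝ) : ∃ B : ℝ, 0 ≤ B ∧ ∀ (x : EuclideanSpace ℝ ι) (w : W), ‖w‖ ≤ R → ‖F (x, w)‖ ≤ B := by
  set Q : Set (EuclideanSpace ℝ ι) := {y | WithLp.ofLp y ∈ Icc (0 : ι → ℝ) (fun _ => L)} with hQ
  have hQc : IsCompact Q :=
    (PiLp.continuousLinearEquiv 2 ℝ (fun _ : ι => ℝ)).toHomeomorph.isCompact_preimage.mpr isCompact_Icc
  have hKc : IsCompact (Q ×ˢ closedBall (0 : W) R) := hQc.prod (isCompact_closedBall 0 R)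
  obtain ⟨B, hB⟩ := hKc.exists_bound_of_continuousOn hF.continuousOn
  refine ⟨max B 0, le_max_right _ _, fun x w hw => ?_⟩
  obtain ⟨x₀, hx₀, hgx⟩ := exists_mem_cell_of_periodic (g := fun x => F (x, w)) hL (fun x i => hFp x i w) x
  change F (x, w) = F (x₀, w) at hgx
  rw [hgx]
  exact (hB (x₀, w) ⟨hx₀, mem_closedBall_zero_iff.2 hw⟩).trans (le_max_left _ _)

end Periodic

/-! ### Local well-posedness on the flat torus -/

section Torus

/-- **Local well-posedness of semilinear heat systems on the flat torus** (Taylor, *PDE III*,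
Ch. 15, §1, for `x`-dependent smooth nonlinearities on `T^d = ℝᵈ/Lℤᵈ`): for every
finite-dimensional real normed space `V`, every smooth `f(x, u, p)` which is `L`-periodic in
`x`, and every smooth `L`-periodic `u₀ : ℝᵈ → V`, the system
`∂ₜu = Σ_μ ∂_μ∂_μ u + f(x, u, ∂u)` has a solution `u`, jointly smooth on `[0, ε) × ℝᵈ` for some
`ε > 0`, `L`-periodic, with `u(0) = u₀` — the hypothesis `hSL` of
`Waldron2019_yangMillsFlow_flatTorus_of_semilinearHeatFree_of_thm11`. Proof: lattice periodicity
makes all derivatives of `f` bounded on `ℝᵈ × {‖w‖ ≤ R}` and all derivatives of `u₀` bounded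
(`exists_bound_of_latticePeriodic`), so the whole-space theorem `exists_smooth_solution` applies; the
solution is periodic by uniqueness, and `Δ = Σ_μ ∂_μ∂_μ` in the standard frame.
[cite: TaylorPDEIII2011, Ch. 15, §1] -/
theorem semilinearHeat_wellPosed_flatTorus {d : ℕ} {V : Type} [NormedAddCommGroup V]
    [NormedSpace ℝ V] [FiniteDimensional ℝ V] (L : ℝ) (hL : 0 < L)
    (f : EuclideanSpace ℝ (Fin d) × V × (EuclideanSpace ℝ (Fin d) →L[ℝ] V) → V) (hf : ContDiff ℝ ∞ f)
    (hfp : ∀ (x : EuclideanSpace ℝ (Fin d)) (i : Fin d) (a : V) (p : EuclideanSpace ℝ (Fin d) →L[ℝ] V),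
      f (x + EuclideanSpace.single i L, a, p) = f (x, a, p))
    (u₀ : EuclideanSpace ℝ (Fin d) → V) (hu₀ : ContDiff ℝ ∞ u₀)
    (hu₀p : ∀ (x : EuclideanSpace ℝ (Fin d)) (i : Fin d), u₀ (x + EuclideanSpace.single i L) = u₀ x) :
    ∃ ε : ℝ, 0 < ε ∧ ∃ u : ℝ → EuclideanSpace ℝ (Fin d) → V,
      u 0 = u₀ ∧
      ContDiffOn ℝ ∞ (fun p : ℝ × EuclideanSpace ℝ (Fin d) => u p.1 p.2) (Ico 0 ε ×ˢ univ) ∧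
      (∀ t : ℝ, 0 ≤ t → t < ε → ∀ (x : EuclideanSpace ℝ (Fin d)) (i : Fin d),
        u t (x + EuclideanSpace.single i L) = u t x) ∧
      ∀ t : ℝ, 0 < t → t < ε → ∀ x : EuclideanSpace ℝ (Fin d),
        deriv (fun s => u s x) t =
          (∑ i, fderiv ℝ (fderiv ℝ (u t)) x (EuclideanSpace.basisFun (Fin d) ℝ i)
            (EuclideanSpace.basisFun (Fin d) ℝ i)) +
          f (x, u t x, fderiv ℝ (u t) x) := by
  classical
  haveI : ProperSpace (V × (EuclideanSpace ℝ (Fin d) →L[ℝ] V)) := by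
    haveI : FiniteDimensional ℝ (V × (EuclideanSpace ℝ (Fin d) →L[ℝ] V)) := inferInstance
    exact FiniteDimensional.proper_real _
  -- ### bounds on the derivatives of `f` on `ℝᵈ × {‖w‖ ≤ R}`
  have hperF : ∀ (j : ℕ) (x : EuclideanSpace ℝ (Fin d)) (i : Fin d) (w : V × (EuclideanSpace ℝ (Fin d) →L[ℝ] V)),
      iteratedFDeriv ℝ j f (x + EuclideanSpace.single i L, w) = iteratedFDeriv ℝ j f (x, w) := by
    intro j x i w
    have hfun : (fun z : EuclideanSpace ℝ (Fin d) × V × (EuclideanSpace ℝ (Fin d) →L[ℝ] V) =>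
        f (z + (EuclideanSpace.single i L, 0))) = f := by
      funext z
      rcases z with ⟨z1, a, p⟩
      simp only [Prod.mk_add_mk, add_zero]
      exact hfp z1 i a p
    have h := iteratedFDeriv_comp_add_right (𝕜 := ℝ) (f := f) j
      ((EuclideanSpace.single i L, 0) : EuclideanSpace ℝ (Fin d) × V × (EuclideanSpace ℝ (Fin d) →L[ℝ] V)) (x, w)
    rw [hfun] at h
    simpa using h.symm
  have hB : ∀ (n : ℕ) (R : ℝ), ∃ B, 0 ≤ B ∧ ∀ j ≤ n, ∀ (x : EuclideanSpace ℝ (Fin d))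
      (w : V × (EuclideanSpace ℝ (Fin d) →L[ℝ] V)), ‖w‖ ≤ R → ‖iteratedFDeriv ℝ j f (x, w)‖ ≤ B := by
    intro n R
    have hj : ∀ j : ℕ, ∃ B, 0 ≤ B ∧ ∀ (x : EuclideanSpace ℝ (Fin d)) (w : V × (EuclideanSpace ℝ (Fin d) →L[ℝ] V)),
        ‖w‖ ≤ R → ‖iteratedFDeriv ℝ j f (x, w)‖ ≤ B := fun j =>
      exists_bound_of_latticePeriodic (hf.continuous_iteratedFDeriv (by exact_mod_cast le_top)) hL
        (fun x i w => hperF j x i w) R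
    choose B hB0 hBb using hj
    refine ⟨∑ j ∈ Finset.range (n + 1), B j, Finset.sum_nonneg fun j _ => hB0 j, fun j hj x w hw => ?_⟩
    exact (hBb j x w hw).trans (Finset.single_le_sum (fun k _ => hB0 k) (Finset.mem_range.2 (Nat.lt_succ_of_le hj)))
  -- ### bounds on the derivatives of `u₀`
  have hA : ∀ n, ∃ A, IsCkBounded n A u₀ := by
    intro n
    have hj : ∀ j : ℕ, ∃ A, 0 ≤ A ∧ ∀ x : EuclideanSpace ℝ (Fin d), ‖iteratedFDeriv ℝ j u₀ x‖ ≤ A := by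
      intro j
      have hper : ∀ (x : EuclideanSpace ℝ (Fin d)) (i : Fin d) (w : ℝ),
          (fun p : EuclideanSpace ℝ (Fin d) × ℝ => iteratedFDeriv ℝ j u₀ p.1) (x + EuclideanSpace.single i L, w) =
            (fun p : EuclideanSpace ℝ (Fin d) × ℝ => iteratedFDeriv ℝ j u₀ p.1) (x, w) := by
        intro x i w
        have hfun : (fun z : EuclideanSpace ℝ (Fin d) => u₀ (z + EuclideanSpace.single i L)) = u₀ :=
          funext fun z => hu₀p z i
        have h := iteratedFDeriv_comp_add_right (𝕜 := ℝ) (f := u₀) j (EuclideanSpace.single i L) x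
        rw [hfun] at h
        exact h.symm
      obtain ⟨A, hA0, hAb⟩ := exists_bound_of_latticePeriodic (W := ℝ)
        (F := fun p : EuclideanSpace ℝ (Fin d) × ℝ => iteratedFDeriv ℝ j u₀ p.1)
        ((hu₀.continuous_iteratedFDeriv (by exact_mod_cast le_top)).comp continuous_fst) hL hper 0
      exact ⟨A, hA0, fun x => hAb x 0 (by simp)⟩
    choose A hA0 hAb using hj
    refine ⟨∑ j ∈ Finset.range (n + 1), A j, hu₀.of_le (by exact_mod_cast le_top), fun j hj x => ?_⟩
    exact (hAb j x).trans (Finset.single_le_sum (fun k _ => hA0 k) (Finset.mem_range.2 (Nat.lt_succ_of_le hj)))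
  -- ### the whole-space theorem
  set P : Set (EuclideanSpace ℝ (Fin d)) := Set.range fun i : Fin d => EuclideanSpace.single i L with hP
  have hfP : ∀ v ∈ P, ∀ (x : EuclideanSpace ℝ (Fin d)) (w : V × (EuclideanSpace ℝ (Fin d) →L[ℝ] V)),
      f (x + v, w) = f (x, w) := by
    rintro _ ⟨i, rfl⟩ x ⟨a, p⟩
    exact hfp x i a p
  have hu₀P : ∀ v ∈ P, ∀ x, u₀ (x + v) = u₀ x := by
    rintro _ ⟨i, rfl⟩ x
    exact hu₀p x i
  obtain ⟨T, hT, u, hu0, hsmooth, hper, hpde⟩ := exists_smooth_solution f hf hB u₀ hA P hfP hu₀P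
  refine ⟨T, hT, u, hu0, hsmooth, fun t _ _ x i => hper _ ⟨i, rfl⟩ t x, fun t ht htT x => ?_⟩
  rw [hpde t ⟨ht, htT⟩ x]
  congr 1
  rw [InnerProductSpace.laplacian_eq_iteratedFDeriv_orthonormalBasis (u t) (EuclideanSpace.basisFun (Fin d) ℝ)]
  refine Finset.sum_congr rfl fun i _ => ?_
  rw [iteratedFDeriv_two_apply]
  rfl

open scoped Matrix.Norms.Frobenius in
/-- **`Waldron2019_yangMillsFlow_flatTorus` from Waldron's Theorem 1.1 alone.** The named fact —
every smooth `𝔲(N)`-valued `L`-periodic connection on `ℝ⁴` launches a smooth global solution of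
the Yang–Mills heat flow on the flat torus, Waldron 2019, Cor. 1.2 — follows from Thm. 1.1 of the
same paper taken verbatim on the closed flat torus (hypothesis (1.1): bounded energy and bounded
integrated `‖D^*F‖²`; conclusion: `lim_{t→T} A(t)` exists in `C^∞_loc`). Everything else is proved
in this directory: semilinear heat well-posedness on `T⁴` (`semilinearHeat_wellPosed_flatTorus`),
the DeTurck trick and gauge ODE (`shortTime_of_semilinearHeat_coord`), the energy identity
giving (1.1) (`energyHypothesis_of_classical`), the smooth extension to `t = T` and the
continuation by restart, junction and Zorn
(`Waldron2019_yangMillsFlow_flatTorus_of_shortTime_of_smoothLimit`).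
[cite: Waldron2019, Thm. 1.1, Cor. 1.2, p. 3] [cite: Struwe1994, §4.1] [cite: TaylorPDEIII2011, Ch. 15, §1] -/
theorem Waldron2019_yangMillsFlow_flatTorus_of_thm11
    (hW : ∀ (N : ℕ) (L : ℝ), 0 < L → ∀ T : ℝ, 0 < T →
      ∀ B : ℝ → Connection (EuclideanSpace ℝ (Fin 4)) (Matrix (Fin N) (Fin N) ℂ),
        ContDiffOn ℝ ∞ (fun p : ℝ × EuclideanSpace ℝ (Fin 4) => B p.1 p.2) (Ico 0 T ×ˢ univ) →
        (∀ t : ℝ, 0 ≤ t → t < T → (B t).IsLatticePeriodic L) →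
        (∀ t : ℝ, 0 < t → t < T →
          (B t).IsValuedIn (skewAdjoint.submodule ℝ (Matrix (Fin N) (Fin N) ℂ))) →
        (∀ t : ℝ, 0 < t → t < T → ∀ x v : EuclideanSpace ℝ (Fin 4),
          deriv (fun s => B s x v) t = divCurvature (B t) x v) →
        (∃ C : ℝ, ∀ t ∈ Ico 0 T,
          ∫ y in {y | WithLp.ofLp y ∈ Icc (0 : Fin 4 → ℝ) (fun i => (0 : Fin 4 → ℝ) i + L)},
            ymDensityOfBasis (EuclideanSpace.basisFun _ ℝ) (B t) y ≤ C) →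
        (∃ C : ℝ, ∀ t₁ t₂ : ℝ, 0 < t₁ → t₁ ≤ t₂ → t₂ < T →
          2 * ∫ s in t₁..t₂,
            ∫ y in {y | WithLp.ofLp y ∈ Icc (0 : Fin 4 → ℝ) (fun i => (0 : Fin 4 → ℝ) i + L)},
              ∑ j, ‖divCurvature (B s) y (EuclideanSpace.basisFun _ ℝ j)‖ ^ 2 ≤ C) →
        ∃ B_T : Connection (EuclideanSpace ℝ (Fin 4)) (Matrix (Fin N) (Fin N) ℂ),
          IsSmoothConnection B_T ∧
          ∀ n : ℕ, TendstoLocallyUniformly (fun t y => iteratedFDeriv ℝ n (B t) y)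
            (iteratedFDeriv ℝ n B_T) (𝓝[<] T)) :
    Waldron2019_yangMillsFlow_flatTorus :=
  Waldron2019_yangMillsFlow_flatTorus_of_semilinearHeatFree_of_thm11
    (fun L hL f hf hfp u₀ hu₀ hu₀p => semilinearHeat_wellPosed_flatTorus L hL f hf hfp u₀ hu₀ hu₀p) hW

end Torus

end Literature.MathematicalPhysics.QuantumLattice
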